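import Summits.ResolutionOfSingularities.ResolutionOfSingularities.Theorems.TightDefectClasses
import HarnessLib

/-!
# UniformWalks — FINITE FIELDS, COMPACTNESS AND SPECIALISATION for the forced point walks of the dim-4 order core
  (decomp-res lens-5 g11; lens «finite range & asymptotic regime»: finite range = FINITE GROUND FIELDS and BOUNDED
  DEGREE (decidable slices), asymptotic regime = ALL perfect fields through an ULTRAPRODUCT (uniformity), bridge =
  SPECIALISATION (Nullstellensatz) + COMPACTNESS (Łoś); --refines MaxContactCut:30253 `NoForcedTowers` through the
  polynomial pure-head slice and the typed forced-walk model of the TREE module `Theorems.TightDefectClasses` (N51;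
  g12 REBASE per CRITIC row 88: the g11 copies of its §1–§2 are DROPPED, `WalksTerminate`, `PolyPureTowersTerminate`,
  `TowerDictionary`, `TowerRealisation`, `IsRoot`, `ForcedWalk`, … are the tree's BY NAME; the port `EffectivePort`
  is RE-TYPED as the schema `EffectivePortAt m₀` for an EXPLICIT bound `m₀` — its existential form was provable by
  choice), anchored BY NAME at the tree items 30253 / `E 1` / 29273.)

(decomp-res node «UniformWalks», lens-5 g11 → g12 REBASED `UniformWalks.lean` sha256 00c8d33cfdb7c8ff;
CRITIC-LEDGER rows 67 / 72
CLEARED-FOR-FILING: MAP +1, pieces 0.)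

[WRITER NOTE (decomp-res writer g5).  Four modules, lens text VERBATIM: this DEFINITIONS file = module docstring + §2 (the node
object `ForcedRun`, `runOf`, `restrict`) + §3 (pieces `SliceTerminate` / `UnifBound` / `UnifFin` / `UnifFinUpTo` /
`AlgWalksTerminate` /
`TangentConeRung` and the three classical ports `CompactnessPort` / `SpecialisationPort` / `EffectivePortAt m₀`,
COSTUME(M), counted 0);
`Theorems.UniformWalkKernels` = §4.1–§4.4 (degree bookkeeping, roots, slice calculus, equivalences mod ports,
`finiteFieldCriterion`);
`Theorems.UniformWalkTangentCone` = §4.6 (the tangent-cone rung PROVED: `tangentConeRung`, `unifBound_two_one`,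
`sliceTerminate_two`);
`Theorems.MaxContactCutUniformWalks` = §4.5 (up/down/kill BY NAME at 30253 `NoForcedTowers`, `E 1`, 29273).  Edits:
route-independent
imports (`Theorems.TightDefectClasses` instead of the by-name `MaxContactCutTightDefect` /
`MaxContactCutExponentLadder`, which only §4.5
needs); lens `ne_zero_of_isolatedTop` = tree `TightDefectStrongWalks.ne_zero_of_isolatedTop` and lens
`coeff_hasseDeriv_eq` = tree
`LassoCut.coeff_hasseDeriv_eq` are CITED, not restated; lens §5 `closes` (= `MaxContactCutExponentLadder.closes`) and
`rungOne_via_forcedTowers` (= `MaxContactCutForcedTowers.rungOne_of_forced`) are the tree's own theorems and are not restated.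
Host asides UWFiniteFieldCriterion / UWAlgWalksTerminate (refining 30253) wait for the MaxContactCut route-edit blocker.]

## The node in one sentence
For the termination statement `WalksTerminate` (no infinite FORCED walk of the tree's typed point-blow-up model
`PointBlowup.State (Fin 3) K` / `PointBlowup.step` from a cleaned root `Z^{pᵉ} + F(u₁,u₂,u₃)`, `K` perfect of
characteristic `p`) — the model image of the slice `PolyPureTowersTerminate` of 30253 — we prove the schema

  `WalksTerminate ⟺ ∀ d, SliceTerminate d`                                   (PROVED, every `F` has a degree)
  `SliceTerminate d ⟺ ∃ B, UnifBound d B`              (⟸ PROVED; ⟹ = port `CompactnessPort`, Łoś + degree bounds)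
  `UnifBound d B ⟺ UnifFin d B`                  (⟹ PROVED; ⟸ = port `SpecialisationPort`, Zariski's lemma + spreading)
  `UnifFin d B ⟸ UnifFinUpTo d B (m₀ d B)`        (port schema `EffectivePortAt m₀`, EXPLICIT effective
Lang–Weil `m₀`; ⟹ PROVED)

hence the **FINITE-FIELD CRITERION** `finiteFieldCriterion : WalksTerminate ⟺ ∀ d, ∃ B, UnifFin d B` (mod the two
classical ports) and the **CERTIFICATE FORM** `WalksTerminate ⟺ ∀ d, ∃ B, UnifFinUpTo d B (m₀ d B)` (mod all
three, for an
EXPLICIT `m₀` — the schema `∃ m₀, EffectivePortAt m₀` is provable by choice and is NOT claimed, CRITIC row 88):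
every degree slice of the termination crux is a `Σ₁` statement — TRUE slices have FINITE CERTIFICATES (a bound `B` and an
exhaustive check over the finite fields `𝔽_{p^m}`, `p^m ≤ m₀(d,B)`, `pᵉ ≤ d`), FALSE slices have
finite-field witnesses
of every length — and the transcendental / infinitely generated perfect fields (the habitat of the tree's non-exhausted
column 0549, where DESCENT fails: lens-5 g6 `FieldColumns`) contribute NOTHING to a termination crux beyond LIMITS of
finite-field behaviour.  The REFUTATION CHANNEL is new: unbounded forced-run lengths over finite fields at ONE degree `d`
(`∀ B, ¬ UnifFin d B` — each instance a finite computation) give `¬ WalksTerminate` (`not_walksTerminate_of_unbounded`),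
hence `¬ PolyPureTowersTerminate` (mod `TowerRealisation`), `¬ MaxContactCut.NoForcedTowers` (30253, BY NAME,
`not_noForcedTowers_of_unbounded`) and `¬ E 1` (mod the tree port `TowerObstructs`, `not_e_one_of_unbounded`) — without
anybody exhibiting an infinite tower over any field.

## Pieces and tags (E-format; «strictly weaker» sentences)
* `SliceTerminate d` — no infinite forced walk from a root of total degree `≤ d`.  WEAKER (instantiation,
  `sliceTerminate_of_walksTerminate`; evidence of strictness: the slices `d < 2` are PROVED vacuous
  (`sliceTerminate_of_lt_two`), and each slice involves only the finitely many exponents `pᵉ ≤ d`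
  (`pow_le_totalDegree_of_run`)) · UNDECIDED for `d ≥ 4` · jointly EXACT (`walksTerminate_iff_slices`).
* `UnifBound d B` — no forced RUN of length `B + 1` from a root of degree `≤ d` over any perfect field.  For the TRUE
  bound `B(d)` this is the ONE EQUIV LAYER of the node (`SliceTerminate d ⟺ ∃ B, UnifBound d B` mod `CompactnessPort`);
  for every SMALLER `B` it is FALSE and finitely refutable, for every larger one equivalent — the residual «the value
  `B(d)`» IS the slice: residual score 0 CONCEDED.  WEAKER than nothing / stronger than the slice by letter
  (`sliceTerminate_of_unifBound`, PROVED).  UNDECIDED(test T-unif-1).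
* `UnifFin d B` — the same over FINITE fields only.  WEAKER by letter (instantiation, `unifFin_of_unifBound`); EXACT
  mod `SpecialisationPort`.  UNDECIDED · INSTRUMENTABLE (T-unif-1: each `(p,e,d,B,𝔽_{p^m})` cell is a finite search).
* `UnifFinUpTo d B m` — the same over finite fields of cardinality `≤ m`: a FINITE CHECK (finitely many fields, finitely
  many roots of degree `≤ d` — `pow_le_totalDegree_of_run` bounds the exponent —, finitely many runs of length `B+1`,
  each step `3 × |K|²` candidate points, isolation decidable by Gröbner bases).  DECIDABLE · WEAKER
  (`unifFinUpTo_of_unifFin`) · the Σ₁-certificate of the slice mod `EffectivePortAt m₀` (explicit `m₀` only).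
* `AlgWalksTerminate` — `WalksTerminate` over perfect fields ALGEBRAIC over `𝔽_p` (every walk then lives over finite
  fields stage by stage).  WEAKER (instantiation, `algWalksTerminate_of_walksTerminate`) · UNDECIDED · NOT known to give
  `WalksTerminate` back: by the criterion the gap is exactly UNIFORMITY in the finite field at fixed degree (run lengths
  finite but unbounded as `m → ∞` would refute `WalksTerminate` over an ultraproduct while `AlgWalksTerminate` holds) —
  INSTRUMENTABLE as the growth-in-`m` flag of T-unif-1.
* `TangentConeRung` — DECIDED (PROVED here, `tangentConeRung`): a root whose residual polynomial IS its tangent cone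
  (`deg F ≤ pᵉ`) has no forced run of length 2 over ANY field (after one step the residual polynomial is free of the chart
  variable, so the top locus contains an axis: `noVar_step_F`, `not_isolatedTop_of_noVar`); hence the CELLS
  `UnifBound 2 1`, `UnifFin 2 1` and the SLICE `SliceTerminate 2` are theorems (`unifBound_two_one`, `sliceTerminate_two`)
  — the first non-vacuous line of the uniformity table is decided, uniformly in the field, exactly as the criterion wants.
* Ports (COSTUME(M), KNOWN-MOD-PORT, counted 0, hypotheses only, never claimed): `CompactnessPort` [Łoś / compactness:
  Marker, Model Theory, Thm 2.1.4 (PDF p.38) and Ex. 2.5.19–2.5.20 (PDF p.74); uniform degree bounds for ideal / radical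
  membership making `IsolatedTop` and the isolation witnesses first-order in bounded degree: van den Dries–Schmidt 1984,
  Invent. Math. 76, 77–91, doi:10.1007/bf01388493, §1 (Hermann bounds); degree growth `totalDegree_step_le` PROVED here],
  `SpecialisationPort` [Zariski's lemma / Hilbert Nullstellensatz (a finitely generated `𝔽_p`-algebra that is a field is
  finite; Mathlib `MvPolynomial` is Jacobson) + spreading out with the finitely many inverses that pin `b_k = 0`, `ord₀`
  and the isolation units — sketch in the docstring], `EffectivePortAt m₀` [Cafure–Matera 2006, Finite Fields Appl. 12 =
  arXiv:math/0405302 p.4: an absolutely irreducible `𝔽_q`-variety of dimension `r`, degree `δ` has `𝔽_q`-points once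
  `q > 2(r+1)δ²`; Bézout for the number / field of definition of components; the EXPLICIT `m₀(d,B)` this yields once the
  degree `δ(d,B)` of the run scheme is bounded is the only instance that carries content], and the TREE ports
  `TowerDictionary` / `TowerRealisation` (`Theorems.TightDefectClasses`, BY NAME) for the up/down links to 30253.
* `closes` reaches `_root_.ResolutionOfSingularities` BY NAME via `MaxContactCutExponentLadder.closes` (aside ladder under
  30253 / 29273; the cone of MaxContactCut is unchanged).

## Why this is novel (relative to the cell and to print)
No node of the cell (TREE.md v0.7.6, N1–N48; CRITIC-LEDGER rows 1–84) quantifies over the GROUND FIELD of a termination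
crux through compactness: lens-1 (alteration degree / Eklof large characteristic `p > p₀(complexity)` — the OTHER corner,
printed as BGMW 2011 Thm 8.0.4, arXiv:1206.3090 p.23), lens-2 (face / τ / generic fibre), lens-3 (tight defect of the
SAME walks — an invariant ALONG the walk), lens-4 (forced / monomial towers — the SHAPE of the walk), lens-6 (purity
valves), and my own g3/g6 (colength; field columns by DESCENT, which fails exactly on the non-exhausted fields that
compactness handles for free).  Here the new lever is ACROSS fields: Łoś turns «all perfect fields» into «finite fields +
uniformity», and Nullstellensatz turns every bounded piece into a finite computation; the instrument bed of the census
(T-moh-3, kit j339089: equimultiple point-blow-up trees over `𝔽_p`, engine `hp_calc.py` = the tree's semantics) thereby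
becomes the DOMAIN of an exact criterion instead of a heuristic.  Presearch (corpus fts+vec and galaxy, 2026-08-30):
«compactness / ultraproduct ⇒ finite-field criterion for a char-p resolution game» — no hits (`lit vsearch`, `lit search
--hybrid "uniform bound number of blow-ups resolution positive characteristic … ultraproduct"`, `lit galaxy search
"resolution of singularities over finite fields|desingularization over finite fields|ultraproduct of resolutions" --star
all` → 3 irrelevant rows); nearest print: BGMW 2011 appendix (effective char-0 ⇒ large `p`; [corpus: arxiv:1206.3090 p.23
Thm 8.0.4]); Kollár 2007 p.35 («over finite fields there are no suitable choices at all» — finite fields defeat GENERIC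
choices, which is why the criterion is not a triviality) and 3.34.2 «Change of fields» (PDF p.131: in characteristic ZERO
independence of the ground field is a property of the functorial ALGORITHM — here, with no algorithm, UNIFORMITY in the
field is exactly what the criterion isolates as the open content of the termination crux); Ax 1968 / Chatzidakis–van den
Dries–Macintyre (ultraproducts of finite fields, Marker p.80) for the method.

## Instrument T-unif-1 (specified for decomp-res-census-1; this seat has no kit)
Engine: HOME/census/moh/hp_calc.py (`step` = chart transform, translation, cleaning, new multiplicities; calibrated on the
tree's §3 example) + Singular local dimension (`ring r = (p^m), (u1,u2,u3), ds; dim(std(J))`) for `IsolatedTop` (`J` =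
Hasse derivatives of order `< q` of `F`).  Cells: `(p,e) ∈ {(2,2),(3,2),(2,3)}`, fields `𝔽_{p^m}`, `m = 1,2,3` (`p = 2`),
`m = 1,2` (`p = 3`); root states = cleaned `F` of total degree `d ∈ {q, q+1, q+2, q+3}` with `ord₀ F ≥ q` and isolated
origin (exhaustive for `(2,2)` at `d ≤ 6` over `𝔽_2`: `≤ 2^{12+21+28}` is too many — sample 10⁶ per cell;
exhaustive over
`𝔽_2` at `d = 4, 5`); output `L(p,e,d,m) = max length of a forced run` (forced = equimultiple ∧ isolated at every blown-up
point; all `3·(p^m)²` points per step), the histogram of run lengths, and the GROWTH FLAG `L(p,e,d,m+1) > L(p,e,d,m)`.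
Readings: a cell with `L` growing in `m` at fixed `d` is EVIDENCE AGAINST `WalksTerminate` (refutation channel); `L`
stable in `m` and moderate in `d` supports `UnifFin` and yields CANDIDATE certificates `(d, B = L)`; `d = q` must return
`L ≤ 1` (tangent-cone data die in one step — a sanity line for the engine).  Existing data cited: T-moh-3 (HOME/census/moh/
T-moh-3.md): at `e = 2` (p = 2 exhaustive monomial×binomial deg ≤ 8; p = 3, 1.6 M samples) residual order oscillates in
Moh's band with NO net growth in 78 M nodes; at `e = 3` net growth occurs (3 602 new maxima) — all over the PRIME field,
i.e. inside `UnifFinUpTo d B p`; T-unif-1 adds isolation and the field-growth axis `m`.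

## Port proof sketches (for the critic; each port is a classical theorem, typed here as a hypothesis)
`CompactnessPort`.  Fix `d`; suppose runs of length `B+1` from degree-`≤ d` roots exist for every `B` (over perfect
`K_B`, exponent `p_B^{e_B} ≤ d` by `pow_le_totalDegree_of_run` — finitely many, so one `(p,e)` serves all `B` by
`ForcedRun.restrict`).  Let `K = ∏ K_B / 𝒰` (non-principal): a perfect field of characteristic `p`.  Coefficientwise
ultraproducts of the states are polynomials because the degrees at stage `i` are `≤ 2^i d` uniformly in `B`
(`totalDegree_run_le`); the multiplicities are bounded likewise; charts `j_i ∈ Fin 3` are `𝒰`-constant; `step`,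
`IsEquimultiplePoint`, `IsRoot` are coefficient identities (Łoś for atomic formulas); `IsolatedTop` transfers because the
witnesses `(N, g, cofactors)` can be chosen of degree `≤ β(d, i)` (van den Dries–Schmidt: Hermann's ideal-membership bound
and constructibility of «the origin is isolated in `V(J_F)`» in bounded degree).  Result: an infinite forced walk over the
perfect field `K` from a root of degree `≤ d`, i.e. `¬ SliceTerminate d`.
`SpecialisationPort`.  A run of length `B+1` over perfect `K` is defined over the finitely generated
`𝔽_p`-subalgebra `A ⊆ K`
generated by all coefficients, points, isolation witnesses with cofactors, the inverses of the units `g_i(0)`, of the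
non-zero `b_{i,k}` and of one lowest-order coefficient of each `pointTransform` (these pin `newMult` and `ord₀`).  For a
maximal ideal `𝔫 ⊂ A`, `A/𝔫` is a FINITE field (Zariski's lemma); reduction mod `𝔫` commutes with `chartTransform`,
`translate`, `deletePthPowers`, `hasseDeriv` (integer formulas) and, thanks to the pinned units, with `newMult` / `ordZero`;
vanishing conditions persist; so the reduced data are a run of length `B+1` over `A/𝔫` from a root of degree `≤ d`.
`EffectivePortAt m₀` (explicit instance).  The runs of length `B+1` at `(p,e,d)` are the `K`-points of an affine
`𝔽_p`-scheme of finite type whose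
number of variables and equation degrees are bounded in `(d,B)` (Rabinowitsch variables for the units); if non-empty it has
a point over `𝔽_{p^{m}}` with `m ≤ μ(d,B)`: a component `Z` (at most `δ^N` of them, Bézout) is defined and absolutely
irreducible over `𝔽_{p^a}`, `a ≤ δ^N`, and has `𝔽_{p^{ab}}`-points as soon as `p^{ab} > 2(dim Z + 1)(deg Z)²`
(Cafure–Matera).  With `p ≤ d` this bounds the field size by `m₀(d,B)`.

References: [Marker2002] D. Marker, Model Theory: An Introduction, GTM 217 (Thm 2.1.4; Ex. 2.5.19, 2.5.20; p.64 notes on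
Ax); [vandenDriesSchmidt1984] doi:10.1007/bf01388493 (acq-00225 cite-only); [CafureMatera2006] arXiv:math/0405302,
doi:10.1016/j.ffa.2005.03.003; [BierstoneGrigorievMilmanWlodarczyk2011] arXiv:1206.3090 §8 Thm 8.0.4; [Kollar2007] Lectures
on Resolution of Singularities p.35; [Hauser2010] §§F–G; [BenitoVillamayoru2013]; [CossartPiltant2019]; lens-3 g9
`TightDefect.lean` rev 3 (HOME/decomp-res-lens-3/g9/, sha256 ce2c464e…) for §1–§2 below; census T-moh-3 (kit j339089).
-/

open CategoryTheory AlgebraicGeometry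
open Literature.AlgebraicGeometry.Resolution
open Summit.ResolutionOfSingularities.ResolutionOfSingularities.Theorems
open Summit.ResolutionOfSingularities.ResolutionOfSingularities.Theorems.WeakOrderReduction
open Summit.ResolutionOfSingularities.ResolutionOfSingularities.Theorems.ForcedTowerClasses
open Summit.ResolutionOfSingularities.ResolutionOfSingularities.Theorems.TightDefectClasses

namespace Summit.ResolutionOfSingularities.ResolutionOfSingularities.Theorems.UniformWalks

/-! ## §2 Forced RUNS over the tree's typed forced-walk model (`Theorems.TightDefectClasses`: `topIdeal`, `IsolatedTop`,
`IsRoot`, `ForcedWalk` BY NAME) -/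

section Model

open MvPolynomial
open Literature.AlgebraicGeometry.Resolution.Hauser2010
open Literature.AlgebraicGeometry.Resolution.PointBlowup

variable {σ : Type} [DecidableEq σ] {K : Type} [Field K] [DecidableEq K]

/-- **NEW TYPED OBJECT of this node: a forced RUN of length `B`** — the first `B` forced steps of a would-be walk: charts
`j i`, points `b i` and the forcing data (equimultiple, isolated) for `i < B`, states `st 0, …, st B`.  Over a FINITE field
and from a root of bounded degree there are only FINITELY MANY runs of each length (`3·|K|²` candidate points per step;
degrees `≤ 2^i · deg F`, `totalDegree_run_le`).  DEFINITION (support). (Sources: Hauser2010, §§F–G.) -/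
structure ForcedRun (q : ℕ) (s₀ : State σ K) (B : ℕ) where
  /-- the chart of the `i`-th point blow-up (`i < B`; junk beyond) -/
  j : ℕ → σ
  /-- the point of the `i`-th exceptional divisor blown up next (`i < B`) -/
  b : ℕ → σ → K
  /-- the states `st 0, …, st B` (junk beyond) -/
  st : ℕ → State σ K
  st_zero : st 0 = s₀
  st_succ : ∀ i, i < B → st (i + 1) = step q (j i) (b i) (st i)
  onExc : ∀ i, i < B → b i (j i) = 0
  equimult : ∀ i, i < B → IsEquimultiplePoint q (j i) (b i) (st i)
  isolated : ∀ i, i < B → IsolatedTop q (st i).F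

/-- Truncation: an infinite forced walk has forced runs of every length. [folklore] -/
def runOf {q : ℕ} {s₀ : State σ K} (W : ForcedWalk q s₀) (B : ℕ) : ForcedRun q s₀ B where
  j := W.j
  b := W.b
  st := W.st
  st_zero := W.st_zero
  st_succ i _ := W.st_succ i
  onExc i _ := W.onExc i
  equimult i _ := W.equimult i
  isolated i _ := W.isolated i

/-- Restriction of a run to a shorter length. [folklore] -/
def ForcedRun.restrict {q : ℕ} {s₀ : State σ K} {B : ℕ} (R : ForcedRun q s₀ B) {B' : ℕ} (h : B' ≤ B) :
    ForcedRun q s₀ B' where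
  j := R.j
  b := R.b
  st := R.st
  st_zero := R.st_zero
  st_succ i hi := R.st_succ i (lt_of_lt_of_le hi h)
  onExc i hi := R.onExc i (lt_of_lt_of_le hi h)
  equimult i hi := R.equimult i (lt_of_lt_of_le hi h)
  isolated i hi := R.isolated i (lt_of_lt_of_le hi h)

end Model

/-! ## §3 The pieces (|σ| = 3; E-format) -/

section Pieces

open Literature.AlgebraicGeometry.Resolution.PointBlowup

/-- **`SliceTerminate d` — the DEGREE SLICE** (finite range in the complexity): no infinite forced walk from a root whose
residual polynomial has total degree `≤ d`.  [WEAKER by letter (`sliceTerminate_of_walksTerminate`); jointly EXACT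
(`walksTerminate_iff_slices`); the slices `d < 2` are vacuous and PROVED (`sliceTerminate_of_lt_two`); only the exponents
`pᵉ ≤ d` enter (`pow_le_totalDegree_of_run`) · UNDECIDED for `d ≥ 4` · Σ₁ mod ports
(`sliceTerminate_iff_exists_unifBound`)] (Sources: Hauser2010, §§F–G.) -/
def SliceTerminate (d : ℕ) : Prop :=
  ∀ p : ℕ, p.Prime → ∀ e : ℕ, 1 ≤ e → ∀ (K : Type) [Field K] [CharP K p] [PerfectField K] [DecidableEq K]
    (s₀ : State (Fin 3) K), IsRoot (p ^ e) s₀ → s₀.F.totalDegree ≤ d → ForcedWalk (p ^ e) s₀ → False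

/-- **`UnifBound d B` — UNIFORM TERMINATION** (the asymptotic regime made finite): over EVERY perfect field of
characteristic `p`, no root of degree `≤ d` admits a forced run of length `B + 1` (all forced walks stop within `B` steps).
[ONE EQUIV LAYER: `SliceTerminate d ⟺ ∃ B, UnifBound d B` mod `CompactnessPort` (`sliceTerminate_iff_exists_unifBound`);
the residual «the true value `B(d)`» is the slice itself — residual score 0 CONCEDED · ⟹ slice PROVED
(`sliceTerminate_of_unifBound`) · monotone in `B` and `d` (PROVED) · UNDECIDED(test T-unif-1)] (Sources:
Marker2002, Thm 2.1.4; Ex. 2.5.19; vandenDriesSchmidt1984, §1.) -/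
def UnifBound (d B : ℕ) : Prop :=
  ∀ p : ℕ, p.Prime → ∀ e : ℕ, 1 ≤ e → ∀ (K : Type) [Field K] [CharP K p] [PerfectField K] [DecidableEq K]
    (s₀ : State (Fin 3) K), IsRoot (p ^ e) s₀ → s₀.F.totalDegree ≤ d → ForcedRun (p ^ e) s₀ (B + 1) → False

/-- **`UnifFin d B` — the FINITE-FIELD PIECE**: the same over FINITE fields only.  [WEAKER by letter (instantiation,
`unifFin_of_unifBound`) · EXACT mod `SpecialisationPort` (`unifBound_iff_unifFin`) · UNDECIDED · INSTRUMENTABLE T-unif-1 ·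
the REFUTATION CHANNEL: `∀ B, ¬ UnifFin d B` (finite-field runs of every length at one degree) ⟹ `¬ WalksTerminate` ⟹
`¬ NoForcedTowers` (30253) mod ports (`not_noForcedTowers_of_unbounded`)] (Sources: Kollar2007, p.35; Marker2002,
p.80 (Ax; ultraproducts of finite fields).) -/
def UnifFin (d B : ℕ) : Prop :=
  ∀ p : ℕ, p.Prime → ∀ e : ℕ, 1 ≤ e → ∀ (K : Type) [Field K] [CharP K p] [PerfectField K] [DecidableEq K] [Finite K]
    (s₀ : State (Fin 3) K), IsRoot (p ^ e) s₀ → s₀.F.totalDegree ≤ d → ForcedRun (p ^ e) s₀ (B + 1) → False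

/-- **`UnifFinUpTo d B m` — the FINITE CHECK**: no forced run of length `B + 1` from a root of degree `≤ d` over a finite
field with at most `m` elements.  [DECIDABLE (finitely many fields `𝔽_{p^{m'}}`, `p^{m'} ≤ m`, `pᵉ ≤ d`; finitely many
roots; finitely many runs; isolation by Gröbner bases) · WEAKER (`unifFinUpTo_of_unifFin`) · with `EffectivePortAt m₀` the
value `m = m₀(d,B)` gives `UnifFin d B` back: the Σ₁ CERTIFICATE of the slice (`walksTerminate_of_certificates`) ·
INSTRUMENTABLE: T-unif-1 computes exactly these cells] (Sources: CafureMatera2006, p.4.) -/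
def UnifFinUpTo (d B m : ℕ) : Prop :=
  ∀ p : ℕ, p.Prime → ∀ e : ℕ, 1 ≤ e → ∀ (K : Type) [Field K] [CharP K p] [PerfectField K] [DecidableEq K] [Fintype K],
    Fintype.card K ≤ m → ∀ (s₀ : State (Fin 3) K), IsRoot (p ^ e) s₀ → s₀.F.totalDegree ≤ d →
    ForcedRun (p ^ e) s₀ (B + 1) → False

/-- **`AlgWalksTerminate` — the POINTWISE finite-field piece**: no infinite forced walk over a perfect field ALGEBRAIC over
`𝔽_p` — typed instance-free as «every element lies in a finite subfield: `x^{pⁿ} = x` for some `n ≥ 1`» — so every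
stage is defined over a finite field.  [WEAKER by letter (`algWalksTerminate_of_walksTerminate`) ·
UNDECIDED · does NOT obviously give `WalksTerminate`: the gap is UNIFORMITY at fixed degree (finiteFieldCriterion) —
INSTRUMENTABLE as the growth-in-`m` flag of T-unif-1] (Sources: Marker2002, p.80.) -/
def AlgWalksTerminate : Prop :=
  ∀ p : ℕ, p.Prime → ∀ e : ℕ, 1 ≤ e → ∀ (K : Type) [Field K] [CharP K p] [PerfectField K] [DecidableEq K],
    (∀ x : K, ∃ n : ℕ, 1 ≤ n ∧ x ^ (p ^ n) = x) → ∀ (s₀ : State (Fin 3) K), IsRoot (p ^ e) s₀ →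
    ForcedWalk (p ^ e) s₀ → False

/-- **`TangentConeRung` — a DECIDED cell of the uniformity table** (`B = 1` on the slice `deg F ≤ pᵉ`, i.e. the
residual polynomial IS its tangent cone): such a root admits NO forced run of length `2`, over EVERY field — after one
point blow-up the new residual polynomial is free of the chart variable `u_j` (`noVar_step_F`), so the top locus
contains the `u_j`-axis and the origin is not isolated (`not_isolatedTop_of_noVar`).  [DECIDED: PROVED here
(`tangentConeRung`); gives the cells `UnifBound 2 1` and `SliceTerminate 2` (PROVED) · WEAKER · the sanity line
`L(p,e,q,m) ≤ 1` of instrument T-unif-1] (the transform is Hauser2010 §F) (Sources: Hauser2010, §F.) -/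
def TangentConeRung : Prop :=
  ∀ p : ℕ, p.Prime → ∀ e : ℕ, 1 ≤ e → ∀ (K : Type) [Field K] [CharP K p] [PerfectField K] [DecidableEq K]
    (s₀ : State (Fin 3) K), IsRoot (p ^ e) s₀ → s₀.F.totalDegree ≤ p ^ e → ForcedRun (p ^ e) s₀ 2 → False

/-! ### The three classical ports (COSTUME(M), KNOWN-MOD-PORT, counted 0 — hypotheses of kernels, never claimed) -/

/-- **PORT `CompactnessPort` (Łoś / compactness + bounded-degree definability).**  If at degree `d` forced runs of EVERY
length exist (over varying perfect fields), then an INFINITE forced walk exists over some perfect field (an ultraproduct)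
from a root of degree `≤ d`.  Proof sketch in the module docstring («Port proof sketches»).  [KNOWN-MOD-PORT(M) ·
COSTUME(cite)] (Sources: Marker2002, Thm 2.1.4 (Compactness); Ex. 2.5.19 (Łoś); vandenDriesSchmidt1984, §1
(bounds for ideal membership / primes in bounded degree).) -/
def CompactnessPort : Prop :=
  ∀ d : ℕ, (∀ B : ℕ, ¬ UnifBound d B) → ¬ SliceTerminate d

/-- **PORT `SpecialisationPort` (Zariski's lemma / Nullstellensatz + spreading out).**  A forced run of length `B + 1`
from a root of degree `≤ d` over ANY perfect field of characteristic `p` specialises to one over a FINITE field (reduce the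
finitely generated `𝔽_p`-algebra of its data modulo a maximal ideal, after inverting the finitely many elements that pin
the zero pattern of the points, the orders and the isolation units).  [KNOWN-MOD-PORT(M) · COSTUME(cite)] (Sources:
Marker2002, Thm 2.1.4; CafureMatera2006, §1.) -/
def SpecialisationPort : Prop :=
  ∀ d B : ℕ, UnifFin d B → UnifBound d B

/-- **PORT SCHEMA `EffectivePortAt m₀` (effective Lang–Weil, for an EXPLICIT bound `m₀ : ℕ → ℕ →
ℕ`).**  A forced run
of length `B + 1` from a root of degree `≤ d` over some finite field already exists over a finite field with `≤ m₀(d,B)`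
elements (the run scheme is of finite type over `𝔽_p`, `p ≤ d`, with complexity bounded in `(d,B)`; a non-empty one has a
point of bounded residue degree: Bézout + Cafure–Matera's `q > 2(r+1)δ²`).  ONLY AN EXPLICIT `m₀` CARRIES CONTENT: the
existential form `∃ m₀, EffectivePortAt m₀` is provable by choice (CRITIC row 88, `effectivePort_by_choice`) and is not a
port; the explicit Cafure–Matera instance needs a degree bound `δ(d,B)` for the run scheme, not typed here (prose only).
[KNOWN-MOD-PORT(M) for the explicit instance · COSTUME(cite) · hypothesis of `walksTerminate_iff_certificates`
only] (Sources: CafureMatera2006, p.4 (estimate for absolutely irreducible varieties, q > 2(r+1)δ²).) -/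
def EffectivePortAt (m₀ : ℕ → ℕ → ℕ) : Prop :=
  ∀ d B : ℕ, UnifFinUpTo d B (m₀ d B) → UnifFin d B


end Pieces

end Summit.ResolutionOfSingularities.ResolutionOfSingularities.Theorems.UniformWalks
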